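import Mathlib
import Summits.KontsevichZagierPeriods.KontsevichZagierPeriods.Theorems.SoloInformedNashSymbol
import Summits.KontsevichZagierPeriods.KontsevichZagierPeriods.Theorems.SoloInformedKZCubeGrid
import Literature.NumberTheory.Transcendental.SemialgebraicMapsProofs
import HarnessLib

/-!
# SoloInformed — κ-classes of bare Nash paths and their subdivision (toolkit for (HT))

File I1 of the (HT) step of the solo-informed programme (`SoloInformedNashHT`: κ̃ is additive
under homotopic concatenation).  The class
`κ̃(s) = (⟦[[0,1], Re(ω(γ)γ′)]⟧, ⟦[[0,1], Im(ω(γ)γ′)]⟧) ∈ V` of a period symbol with Nash path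
(`soloInformedKappaTilde`) only uses the forms `ω` and the map `γ`, not the curve nor the
algebraicity of the endpoints.  We therefore define it for BARE data — forms `ω` with algebraic
coefficients and a Nash map `γ : ℝ → ℂⁿ` (`soloInformedKappaPath`; `κ̃` is an instance,
`soloInformedKappaTilde_eq_kappaPath`) — and prove the **subdivision formula**

  `κ(ω, γ) = ∑_{k < N} κ(ω, u ↦ γ((k + u)/N))`            (`soloInformed_kappaPath_subdiv`)

inside the Kontsevich–Zagier calculus: the reparametrised pieces `γₖ(u) = γ((k+u)/N)` are Nash
(`soloInformed_isNashPath_piece`), their path integrands are `N⁻¹ · (ω(γ)γ′)((k+u)/N)` (chain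
rule), and `[[0,1], g] − ∑ₖ [[0,1], N⁻¹ g((k+·)/N)] ∈ KZ.relations` is the one-dimensional grid
subdivision `soloInformed_grid_mem_relations` (domain additivity + affine change of variables).
The point: the subdivision times `k/N` have transcendental images `γ(k/N)`, so the pieces are not
period symbols, but they are Kontsevich–Zagier integral representations.

References: Kontsevich–Zagier 2001, §1.2 rules (1), (2); Huber–Wüstholz 2022, Ch. 13.
-/

noncomputable section

open scoped BigOperators
open MeasureTheory Set MvPolynomial
open Literature.NumberTheory.Transcendental Literature.NumberTheory.Transcendental.KZ
open Literature.NumberTheory.Transcendental.CurvePeriods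
open Literature.ModelTheory.ExponentialFields

namespace Summit.KontsevichZagierPeriods.KontsevichZagierPeriods.Theorems

variable {n : ℕ}

/-! ## 1. The path integrand of bare data `(ω, γ)` -/

/-- The integrand `t ↦ Σᵢ ωᵢ(γ(t)) · γᵢ′(t)` of `∫_γ ω` for bare data. -/
def soloInformedFormIntegrand (ω : Fin n → MvPolynomial (Fin n) ℂ) (γ : ℝ → Fin n → ℂ)
    (t : ℝ) : ℂ :=
  ∑ i, eval (γ t) (ω i) * deriv (fun u => γ u i) t

/-- The path integrand of a symbol is the form integrand of its data. -/
theorem soloInformedPathIntegrand_eq (s : PeriodSymbol) :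
    soloInformedPathIntegrand s = soloInformedFormIntegrand s.ω s.γ.toFun := rfl

/-- The form integrand of a Nash map has semialgebraic real and imaginary parts on `(−ε, 1 + ε)`. -/
theorem soloInformed_reImSA_formIntegrand_Ioo {ω : Fin n → MvPolynomial (Fin n) ℂ}
    (hω : ∀ i, HasAlgCoeffs (ω i)) {γ : ℝ → Fin n → ℂ} {ε : ℚ} (hε : 0 < ε)
    (hd : ContDiffOn ℝ 1 γ (Ioo (-(ε : ℝ)) (1 + ε)))
    (hsa : ∀ i, SoloInformedReImSA (soloInformedIoo1 (-(ε : ℝ)) (1 + ε)) (fun t => γ (t 0) i)) :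
    SoloInformedReImSA (soloInformedIoo1 (-(ε : ℝ)) (1 + ε))
      (fun t => soloInformedFormIntegrand ω γ (t 0)) := by
  have hs := isSemialgebraic_soloInformedIoo1 (-ε) (1 + ε)
  push_cast at hs
  unfold soloInformedFormIntegrand
  refine SoloInformedReImSA.sum hs _ fun i _ => ?_
  exact (SoloInformedReImSA.eval_poly hs hsa (hω i)).mul (soloInformed_reImSA_deriv hε hd hsa i)

/-- The form integrand of a `C¹` map is continuous on the open interval. -/
theorem soloInformed_continuousOn_formIntegrand (ω : Fin n → MvPolynomial (Fin n) ℂ)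
    {γ : ℝ → Fin n → ℂ} {a b : ℝ} (hd : ContDiffOn ℝ 1 γ (Ioo a b)) :
    ContinuousOn (soloInformedFormIntegrand ω γ) (Ioo a b) := by
  unfold soloInformedFormIntegrand
  refine continuousOn_finsetSum _ fun i _ => ContinuousOn.mul ?_ ?_
  · exact (continuous_eval (ω i)).comp_continuousOn hd.continuousOn
  · exact (contDiffOn_pi.mp hd i).continuousOn_deriv_of_isOpen isOpen_Ioo le_rfl

section KappaPath

variable (ω : Fin n → MvPolynomial (Fin n) ℂ) (hω : ∀ i, HasAlgCoeffs (ω i))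
  (γ : ℝ → Fin n → ℂ) (h : SoloInformedIsNashPath γ)
include hω h

/-- Real part of the form integrand is `ℚ`-semialgebraic on `[0, 1]` (Nash map). -/
theorem soloInformed_sa_re_formIntegrand :
    IsSemialgebraicFunOn ℚ soloInformedUnitI
      (fun t => (soloInformedFormIntegrand ω γ (t 0)).re) := by
  obtain ⟨ε, hε, hd, hsa⟩ := h
  have hε' : (0 : ℝ) < ε := by exact_mod_cast hε
  exact (soloInformed_reImSA_formIntegrand_Ioo hω hε hd hsa).1.mono
    (soloInformedUnitI_subset_Ioo1 hε') isSemialgebraic_soloInformedUnitI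

/-- Imaginary part of the form integrand is `ℚ`-semialgebraic on `[0, 1]` (Nash map). -/
theorem soloInformed_sa_im_formIntegrand :
    IsSemialgebraicFunOn ℚ soloInformedUnitI
      (fun t => (soloInformedFormIntegrand ω γ (t 0)).im) := by
  obtain ⟨ε, hε, hd, hsa⟩ := h
  have hε' : (0 : ℝ) < ε := by exact_mod_cast hε
  exact (soloInformed_reImSA_formIntegrand_Ioo hω hε hd hsa).2.mono
    (soloInformedUnitI_subset_Ioo1 hε') isSemialgebraic_soloInformedUnitI

omit hω in
/-- The form integrand of a Nash map is continuous on `[0, 1]` (`ℝ¹` spelling). -/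
theorem soloInformed_continuousOn_formIntegrand_unitI :
    ContinuousOn (fun t : Fin 1 → ℝ => soloInformedFormIntegrand ω γ (t 0)) soloInformedUnitI := by
  obtain ⟨ε, hε, hd, _⟩ := h
  have hε' : (0 : ℝ) < ε := by exact_mod_cast hε
  exact (soloInformed_continuousOn_comp_apply_zero
    (soloInformed_continuousOn_formIntegrand ω hd)).mono (soloInformedUnitI_subset_Ioo1 hε')

/-- **`[[0,1], Re(ω(γ)γ′)]`** for bare Nash data. -/
def soloInformedFormRepRe : IntegralRep 1 :=
  soloInformedIRep _ (soloInformed_sa_re_formIntegrand ω hω γ h)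
    (Complex.continuous_re.comp_continuousOn
      (soloInformed_continuousOn_formIntegrand_unitI ω γ h))

/-- **`[[0,1], Im(ω(γ)γ′)]`** for bare Nash data. -/
def soloInformedFormRepIm : IntegralRep 1 :=
  soloInformedIRep _ (soloInformed_sa_im_formIntegrand ω hω γ h)
    (Complex.continuous_im.comp_continuousOn
      (soloInformed_continuousOn_formIntegrand_unitI ω γ h))

/-- Domain of the real representation. -/
@[simp] theorem soloInformedFormRepRe_domain :
    (soloInformedFormRepRe ω hω γ h).domain = soloInformedUnitI := rfl

/-- Integrand of the real representation. -/
@[simp] theorem soloInformedFormRepRe_integrand :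
    (soloInformedFormRepRe ω hω γ h).integrand =
      fun t => (soloInformedFormIntegrand ω γ (t 0)).re := rfl

/-- Domain of the imaginary representation. -/
@[simp] theorem soloInformedFormRepIm_domain :
    (soloInformedFormRepIm ω hω γ h).domain = soloInformedUnitI := rfl

/-- Integrand of the imaginary representation. -/
@[simp] theorem soloInformedFormRepIm_integrand :
    (soloInformedFormRepIm ω hω γ h).integrand =
      fun t => (soloInformedFormIntegrand ω γ (t 0)).im := rfl

/-- **`κ(ω, γ) = (⟦[[0,1], Re(ω(γ)γ′)]⟧, ⟦[[0,1], Im(ω(γ)γ′)]⟧) ∈ V`** for bare Nash data. -/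
def soloInformedKappaPath : SoloInformedV :=
  SoloInformedV.mk (toFormalPeriod (of (soloInformedFormRepRe ω hω γ h)))
    (toFormalPeriod (of (soloInformedFormRepIm ω hω γ h)))

/-- First component of `κ(ω, γ)`. -/
@[simp] theorem soloInformedKappaPath_fst :
    (soloInformedKappaPath ω hω γ h).fst =
      toFormalPeriod (of (soloInformedFormRepRe ω hω γ h)) := rfl

/-- Second component of `κ(ω, γ)`. -/
@[simp] theorem soloInformedKappaPath_snd :
    (soloInformedKappaPath ω hω γ h).snd =
      toFormalPeriod (of (soloInformedFormRepIm ω hω γ h)) := rfl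

end KappaPath

/-- **`κ̃` of a symbol is `κ` of its data.** -/
theorem soloInformedKappaTilde_eq_kappaPath (s : PeriodSymbol)
    (h : SoloInformedIsNashPath s.γ.toFun) :
    soloInformedKappaTilde s h = soloInformedKappaPath s.ω s.ω_algebraic s.γ.toFun h := rfl

/-! ## 2. Reparametrised pieces `γₖ(u) = γ((k + u)/N)` -/

/-- The `k`-th of `N` pieces of `γ`, reparametrised to `[0, 1]`: `u ↦ γ((k + u)/N)`. -/
def soloInformedPiecePath (γ : ℝ → Fin n → ℂ) (N k : ℕ) (u : ℝ) : Fin n → ℂ :=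
  γ (((k : ℝ) + u) / N)

/-- The affine reparametrisation maps `(−ε, 1 + ε)` into itself for `k < N`. -/
theorem soloInformed_piece_arg_mem {ε : ℝ} (hε : 0 < ε) {N k : ℕ} (hk : k < N) {u : ℝ}
    (hu : u ∈ Ioo (-ε) (1 + ε)) : ((k : ℝ) + u) / N ∈ Ioo (-ε) (1 + ε) := by
  have hN : (0 : ℝ) < N := by exact_mod_cast (Nat.zero_lt_of_lt hk)
  have hN1 : (1 : ℝ) ≤ N := by exact_mod_cast (Nat.zero_lt_of_lt hk)
  have hkN : (k : ℝ) + 1 ≤ N := by exact_mod_cast hk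
  have hk0 : (0 : ℝ) ≤ k := by exact_mod_cast Nat.zero_le k
  obtain ⟨hu1, hu2⟩ := hu
  constructor
  · rw [lt_div_iff₀ hN]; nlinarith
  · rw [div_lt_iff₀ hN]; nlinarith

/-- The affine reparametrisation has derivative `N⁻¹`. -/
theorem soloInformed_hasDerivAt_piece_arg (N k : ℕ) (u : ℝ) :
    HasDerivAt (fun u : ℝ => ((k : ℝ) + u) / N) ((N : ℝ)⁻¹) u := by
  have h := ((hasDerivAt_id' u).const_add (k : ℝ)).div_const (N : ℝ)
  simpa [one_div] using h

/-- **Chain rule for the pieces:** the form integrand of `γₖ` at `u` is `N⁻¹` times that of `γ` at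
`(k + u)/N`, wherever `γ` is differentiable there. -/
theorem soloInformedFormIntegrand_piece (ω : Fin n → MvPolynomial (Fin n) ℂ) {γ : ℝ → Fin n → ℂ}
    {N k : ℕ} {u : ℝ} (hγ : DifferentiableAt ℝ γ (((k : ℝ) + u) / N)) :
    soloInformedFormIntegrand ω (soloInformedPiecePath γ N k) u =
      ((N : ℝ)⁻¹ : ℂ) * soloInformedFormIntegrand ω γ (((k : ℝ) + u) / N) := by
  unfold soloInformedFormIntegrand soloInformedPiecePath
  rw [Finset.mul_sum]
  refine Finset.sum_congr rfl fun i _ => ?_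
  have hi : DifferentiableAt ℝ (fun v => γ v i) (((k : ℝ) + u) / N) := differentiableAt_pi.mp hγ i
  have hc0 := hi.hasDerivAt.scomp u (soloInformed_hasDerivAt_piece_arg N k u)
  have hc : HasDerivAt (fun v : ℝ => γ (((k : ℝ) + v) / N) i)
      (((N : ℝ)⁻¹) • deriv (fun v => γ v i) (((k : ℝ) + u) / N)) u := hc0
  rw [hc.deriv, Complex.real_smul]
  push_cast
  ring

/-- **The pieces of a Nash map are Nash** (for `0 < N`, `k < N`; same `ε`). -/
theorem soloInformed_isNashPath_piece {γ : ℝ → Fin n → ℂ} (h : SoloInformedIsNashPath γ)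
    {N k : ℕ} (hk : k < N) : SoloInformedIsNashPath (soloInformedPiecePath γ N k) := by
  obtain ⟨ε, hε, hd, hsa⟩ := h
  have hε' : (0 : ℝ) < ε := by exact_mod_cast hε
  have hmaps : MapsTo (fun u : ℝ => ((k : ℝ) + u) / N) (Ioo (-(ε : ℝ)) (1 + ε))
      (Ioo (-(ε : ℝ)) (1 + ε)) := fun u hu => soloInformed_piece_arg_mem hε' hk hu
  refine ⟨ε, hε, ?_, fun i => ?_⟩
  · have ha : ContDiff ℝ 1 (fun u : ℝ => ((k : ℝ) + u) / N) :=
      (contDiff_const.add contDiff_id).div_const _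
    exact hd.comp ha.contDiffOn hmaps
  · -- semialgebraicity: compose with the polynomial map `t ↦ ((k + t 0)/N)`
    have hS := isSemialgebraic_soloInformedIoo1 (-ε) (1 + ε)
    push_cast at hS
    set f : (Fin 1 → ℝ) → (Fin 1 → ℝ) := fun t _ => ((k : ℝ) + t 0) / N with hf
    have hfs : IsSemialgebraicMapOn ℚ (soloInformedIoo1 (-(ε : ℝ)) (1 + ε)) f := by
      convert isSemialgebraicMapOn_aeval hS
        (fun _ : Fin 1 => MvPolynomial.C ((k : ℚ) / N) + MvPolynomial.C ((1 : ℚ) / N) * X 0)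
        using 2 with t
      ext j
      simp only [hf, map_add, map_mul, MvPolynomial.aeval_C, MvPolynomial.aeval_X, eq_ratCast]
      push_cast
      ring
    have hfm : MapsTo f (soloInformedIoo1 (-(ε : ℝ)) (1 + ε))
        (soloInformedIoo1 (-(ε : ℝ)) (1 + ε)) := fun t ht => hmaps ht
    have h1 := IsSemialgebraicFunOn.comp_isSemialgebraicMapOn_holds (hsa i).1 hfs hfm
    have h2 := IsSemialgebraicFunOn.comp_isSemialgebraicMapOn_holds (hsa i).2 hfs hfm
    exact ⟨h1, h2⟩

/-! ## 3. Subdivision inside the KZ calculus -/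

/-- `[0, 1] ⊆ ℝ¹` is the one-dimensional unit cube. -/
theorem soloInformedUnitI_eq_cube : soloInformedUnitI = soloInformedCube 1 := by
  ext t
  simp only [soloInformedUnitI, mem_setOf_eq, soloInformed_mem_cube_iff, Fin.forall_fin_one]

/-- On `[0, 1]`, the real representation of the `k`-th piece has integrand
`N⁻¹ · Re(ω(γ)γ′)((k + x)/N)`. -/
theorem soloInformedFormRepRe_piece_integrand (ω : Fin n → MvPolynomial (Fin n) ℂ)
    (hω : ∀ i, HasAlgCoeffs (ω i)) {γ : ℝ → Fin n → ℂ} (h : SoloInformedIsNashPath γ) {N : ℕ}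
    (j : Fin 1 → Fin N) (hk : ((j 0 : ℕ)) < N) (x : Fin 1 → ℝ) (hx : x ∈ soloInformedCube 1) :
    (soloInformedFormRepRe ω hω _ (soloInformed_isNashPath_piece h hk)).integrand x =
      ((N : ℝ)⁻¹) ^ 1 *
        (soloInformedFormRepRe ω hω γ h).integrand (soloInformedGridMap N j x) := by
  obtain ⟨ε, hε, hd, _⟩ := h
  have hε' : (0 : ℝ) < ε := by exact_mod_cast hε
  have hx' : (((j 0 : ℕ) : ℝ) + x 0) / N ∈ Ioo (-(ε : ℝ)) (1 + ε) := by
    rw [← soloInformedUnitI_eq_cube] at hx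
    exact soloInformed_piece_arg_mem hε' hk (soloInformedUnitI_subset_Ioo1 hε' hx)
  have hγ : DifferentiableAt ℝ γ ((((j 0 : ℕ) : ℝ) + x 0) / N) :=
    (hd.differentiableOn one_ne_zero _ hx').differentiableAt (isOpen_Ioo.mem_nhds hx')
  simp only [soloInformedFormRepRe_integrand, pow_one]
  rw [soloInformedFormIntegrand_piece ω hγ, ← Complex.ofReal_inv, Complex.re_ofReal_mul]
  rfl

/-- Imaginary counterpart of `soloInformedFormRepRe_piece_integrand`. -/
theorem soloInformedFormRepIm_piece_integrand (ω : Fin n → MvPolynomial (Fin n) ℂ)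
    (hω : ∀ i, HasAlgCoeffs (ω i)) {γ : ℝ → Fin n → ℂ} (h : SoloInformedIsNashPath γ) {N : ℕ}
    (j : Fin 1 → Fin N) (hk : ((j 0 : ℕ)) < N) (x : Fin 1 → ℝ) (hx : x ∈ soloInformedCube 1) :
    (soloInformedFormRepIm ω hω _ (soloInformed_isNashPath_piece h hk)).integrand x =
      ((N : ℝ)⁻¹) ^ 1 *
        (soloInformedFormRepIm ω hω γ h).integrand (soloInformedGridMap N j x) := by
  obtain ⟨ε, hε, hd, _⟩ := h
  have hε' : (0 : ℝ) < ε := by exact_mod_cast hε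
  have hx' : (((j 0 : ℕ) : ℝ) + x 0) / N ∈ Ioo (-(ε : ℝ)) (1 + ε) := by
    rw [← soloInformedUnitI_eq_cube] at hx
    exact soloInformed_piece_arg_mem hε' hk (soloInformedUnitI_subset_Ioo1 hε' hx)
  have hγ : DifferentiableAt ℝ γ ((((j 0 : ℕ) : ℝ) + x 0) / N) :=
    (hd.differentiableOn one_ne_zero _ hx').differentiableAt (isOpen_Ioo.mem_nhds hx')
  simp only [soloInformedFormRepIm_integrand, pow_one]
  rw [soloInformedFormIntegrand_piece ω hγ, ← Complex.ofReal_inv, Complex.im_ofReal_mul]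
  rfl

/-- **Subdivision of `κ` inside the KZ calculus.** For a Nash map `γ` and `N ≥ 1`,
`κ(ω, γ) = ∑_{k < N} κ(ω, γₖ)` with `γₖ(u) = γ((k + u)/N)`: domain additivity over the `N`
intervals `[k/N, (k+1)/N]` and one affine change of variables per interval
(`soloInformed_grid_mem_relations`, `n = 1`). [Kontsevich–Zagier 2001, §1.2 (1), (2)] -/
theorem soloInformed_kappaPath_subdiv (ω : Fin n → MvPolynomial (Fin n) ℂ)
    (hω : ∀ i, HasAlgCoeffs (ω i)) {γ : ℝ → Fin n → ℂ} (h : SoloInformedIsNashPath γ) {N : ℕ}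
    (hN : 0 < N) :
    soloInformedKappaPath ω hω γ h =
      ∑ k : Fin N, soloInformedKappaPath ω hω (soloInformedPiecePath γ N k)
        (soloInformed_isNashPath_piece h k.2) := by
  -- reindex the sum over `Fin 1 → Fin N`
  have hre : ∀ F : Fin N → SoloInformedV,
      ∑ k : Fin N, F k = ∑ j : Fin 1 → Fin N, F (j 0) := fun F =>
    (Fintype.sum_equiv (Equiv.funUnique (Fin 1) (Fin N)) _ _ fun _ => rfl).symm
  rw [hre]
  ext
  · simp only [soloInformedKappaPath_fst, SoloInformedV.fst_sum]
    rw [← map_sum, toFormalPeriod_eq_iff]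
    exact soloInformed_grid_mem_relations hN _ (soloInformedUnitI_eq_cube)
      (fun j => soloInformedFormRepRe ω hω _ (soloInformed_isNashPath_piece h (j 0).2))
      (fun _ => soloInformedUnitI_eq_cube)
      fun j x hx => soloInformedFormRepRe_piece_integrand ω hω h j (j 0).2 x hx
  · simp only [soloInformedKappaPath_snd, SoloInformedV.snd_sum]
    rw [← map_sum, toFormalPeriod_eq_iff]
    exact soloInformed_grid_mem_relations hN _ (soloInformedUnitI_eq_cube)
      (fun j => soloInformedFormRepIm ω hω _ (soloInformed_isNashPath_piece h (j 0).2))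
      (fun _ => soloInformedUnitI_eq_cube)
      fun j x hx => soloInformedFormRepIm_piece_integrand ω hω h j (j 0).2 x hx

/-- **Subdivision of `κ̃`.** For a symbol with Nash path, `κ̃(s) = ∑_{k<N} κ(ω, γₖ)`. -/
theorem soloInformed_kappaTilde_subdiv (s : PeriodSymbol) (h : SoloInformedIsNashPath s.γ.toFun)
    {N : ℕ} (hN : 0 < N) :
    soloInformedKappaTilde s h =
      ∑ k : Fin N, soloInformedKappaPath s.ω s.ω_algebraic (soloInformedPiecePath s.γ.toFun N k)
        (soloInformed_isNashPath_piece h k.2) := by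
  rw [soloInformedKappaTilde_eq_kappaPath]
  exact soloInformed_kappaPath_subdiv s.ω s.ω_algebraic h hN

end Summit.KontsevichZagierPeriods.KontsevichZagierPeriods.Theorems
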